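import Summits.SmoothPoincare4.SmoothPoincare4.Theses.SymplecticOrigami
import Literature.Geometry.Symplectic.PlusOneSphereRigidity

/-!
# Item `McDuffWendlAffinePair` (stmt-SmoothPoincare4-14052) — closure by the named fact

The route declaration
`Summit.SmoothPoincare4.SmoothPoincare4.Theses.SymplecticOrigami.McDuffWendlAffinePair`
(support item of route `SymplecticOrigami`, premise `hMW` of the genus-`0` branch of the crux
`OrigamiRung`, line pair-rigidity-endgame) is, binder for binder, the body of the tree's named fact
`Literature.Geometry.Symplectic.mcduffWendl_plusOneSphere_affinePair`
(`Literature/Geometry/Symplectic/PlusOneSphereRigidity.lean`): McDuff 1990 (JAMS 3) Thm. 1.4 +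
Cor. 1.5 (i) = Wendl 2018 Thm. D (2) — a closed connected minimal symplectic `4`-manifold with a
symplectically embedded `(+1)`-sphere `S` is `(ℂP², line)` — in affine complement form.

This file records that identity (`mcDuffWendlAffinePair_iff_affinePairFact`, by `Iff.rfl`) and the
CONDITIONAL closure of the item over the named fact (`mcDuffWendlAffinePair_of_affinePairFact`).
The fact itself is not proved in the tree (its proof is Gromov–McDuff `J`-holomorphic curve
theory); the item therefore stays formalisation debt whose trust base is exactly that one name.
-/

-- the prescribed namespace `Summit.<P>.<Sub>.…` duplicates `SmoothPoincare4` (P = Sub)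
set_option linter.dupNamespace false

namespace Summit.SmoothPoincare4.SmoothPoincare4.Theorems

open Literature.Geometry.Symplectic (mcduffWendl_plusOneSphere_affinePair)

/-- The route item `McDuffWendlAffinePair` is LITERALLY the named fact
`Literature.Geometry.Symplectic.mcduffWendl_plusOneSphere_affinePair` (McDuff 1990, Thm. 1.4 +
Cor. 1.5 (i); Wendl 2018, Thm. D (2); affine complement form): the two propositions are
definitionally equal. -/
theorem mcDuffWendlAffinePair_iff_affinePairFact :
    Theses.SymplecticOrigami.McDuffWendlAffinePair ↔ mcduffWendl_plusOneSphere_affinePair :=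
  Iff.rfl

/-- **Conditional closure of item stmt-SmoothPoincare4-14052.** The route declaration
`McDuffWendlAffinePair` holds over the named fact
`Literature.Geometry.Symplectic.mcduffWendl_plusOneSphere_affinePair` (McDuff 1990, Thm. 1.4 +
Cor. 1.5 (i) = Wendl 2018, Thm. D (2), affine complement form). Trust base: that one name. -/
theorem mcDuffWendlAffinePair_of_affinePairFact (h : mcduffWendl_plusOneSphere_affinePair) :
    Theses.SymplecticOrigami.McDuffWendlAffinePair :=
  mcDuffWendlAffinePair_iff_affinePairFact.2 h

end Summit.SmoothPoincare4.SmoothPoincare4.Theorems
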